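import Summits.AtomisticToContinuum.BoseEinsteinCondensation.Theses.BECCovarianceTransport

/-!
# Birth skeleton for crux `EnergyExcessDecay` (stmt-AtomisticToContinuum-12683)

Route `BECCovarianceTransport` (route-AtomisticToContinuum-BECCovarianceTransport), sub-problem
`BoseEinsteinCondensation`, crux rank 2 (the route's hardest item).  Registered by
planner-skel-stmt-AtomisticToContinuum-12683-0 (2026-08-17, skeleton-register one-shot).
`Disproof.lean` for this crux: none exists (`ledger crux ls stmt-AtomisticToContinuum-12683`: no workfiles)
— nothing to honour or avoid yet; negatives index untouched (the crux survives its refuter attack, Gaussian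
level checked twice: `(E_t − E₀)t⁴c³/L³ ↑ π²/7680` from below, no `L^ε`, no `log L`).

## The crux (route file, item docstring)

For every repulsive finite-range `v` there are `C, ρ₀ > 0` such that for `0 < ρ < ρ₀` and all large `N`,
with `L = (N/ρ)^{1/3}`, `a` = scattering length, `c = √(16πρa)`, the torus Feynman–Kac flow of the CONSTANT
`Φ_t(X) = E[expNeg(∫₀ᵗ ∑_{i<j} v^per(Bⁱ_s − Bʲ_s) ds)]` and `Z(t) = ∫_{cell^N} Φ_t²`:
for all `t ≥ Cc⁻²` and `0 < h ≤ h'`,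
`(log Z(t) − log Z(t+h))/h − (log Z(t) − log Z(t+h'))/h' ≤ 2C L³c⁻³t⁻⁴`
— the derivative- and limit-free encoding of `E_t − E_∞ ≤ C L³c⁻³t⁻⁴` (`E_t = −(log Z)'/2`, `log Z` convex).

## The line (three stubs, composition kernel-checked)

Read the crux on the SPECTRAL SIDE of the flow, over energies in `[0, ∞]` (`ℝ≥0∞`-valued, so that the
hard-core-killed part of the constant state is an atom at `E = ⊤`, `expNeg(2t·⊤) = 𝟙{t = 0}`, and the
representation holds for EVERY `t ≥ 0` including `t = 0`; this is the Berg–Christensen–Ressel / Bernstein form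
of a bounded positive-definite function on the semigroup `(ℝ₊, +)`, with its mass at infinity).

* `stub_spectralMeasure : Sig.stub_spectralMeasure` — IDENTIFICATION / DICTIONARY [size L]: for admissible `v`,
  `ρ > 0` and all large `N` there is a finite measure `μ` on `[0, ∞]` with
  `∫_{cell^N} Φ_t² = ∫ expNeg(2tE) dμ(E)` for all `t ≥ 0`.  Mechanism: semigroup (Markov) law of the periodic FK
  weight (`PeriodicHeatFlow.lean`) + time-reversal symmetry `⟨f, e^{-tH}g⟩_cell = ⟨e^{-tH}f, g⟩_cell` ⇒
  `Z(t) = ⟨1, e^{-2tH}1⟩_cell` is bounded positive-definite on `(ℝ₊,+)` ⇒ Laplace transform of a finite measure on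
  `[0, ∞]` (BCR Thm 4.4.?/Bernstein–Widder; equivalently the spectral theorem for the self-adjoint contraction
  semigroup on the closure of its range).  Bounded `v^per`: this is the named fact
  `PeriodicHeatFlowSpectralMeasure` (`PeriodicHeatFlowSpectral.lean`) pushed forward along `ENNReal.ofReal`
  (`Φ_t = periodicFKSemigroup v L t 1`, `periodicHeatFlow_ofReal_eq_periodicFKSemigroup`); hard cores: the atom at
  `⊤` has mass `vol(cell^N ∖ accessible)`.
* `stub_energyExcessBound : Sig.stub_energyExcessBound` — THE PHYSICS [size XL, the HARDEST stub]: for any such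
  `μ` there is a finite level `E₀` carrying no mass below it (`μ(Iio E₀) = 0`) with, for `t ≥ Cc⁻²`,
  `∫ E e^{-2tE} dμ ≤ (E₀ + C L³c⁻³t⁻⁴) ∫ e^{-2tE} dμ`: the Gibbs-tilted mean of the spectral measure of the
  constant state exceeds the bottom of its support by at most the Planck bound — literally "`E_t − E_∞ ≤
  C L³c⁻³t⁻⁴`" (the bound forces `E₀ = inf supp μ = E_∞`).  Bogoliubov value `(π²/7680)L³c⁻³t⁻⁴`; expected
  attack: Ginibre cluster expansion of `log Z(t)` in the time direction for `t ≲ 1/(ρa)` (energy to LHY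
  precision), then the multiplicative (independent-shell) structure of `μ` for the phonon tail.  WHY IT MIGHT
  FAIL: as the crux (two-sided statement on the spectral measure of `1` down to one two-phonon quantum `4πc/L`,
  uniform in `L`; a slow non-phonon branch, an uncut two-body `t^{-1/2}` tail, or a `log L` kills it).
* `stub_laplaceTilt : Sig.stub_laplaceTilt` — ABSTRACT LAPLACE-TRANSFORM GLUE [size M, provable now]: for a
  finite measure `μ` on `[0,∞]`, a level `E₀ : ℝ≥0` with `μ(Iio E₀) = 0`, `B ≥ 0`, `t ≥ 0`, `0 < h ≤ h'`:
  if the tilted mean at `t` is `≤ E₀ + B` (multiplied out, in `ℝ≥0∞`) then the crux's finite-difference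
  expression of `Z(s) = (∫ expNeg(2sE) dμ).toReal` at `(t, h, h')` is `≤ 2B`.  Proof on paper: if the tilted
  mass at `t` vanishes all three `Z` vanish (`Real.log 0 = 0`, LHS `= 0`); otherwise the hypothesis makes
  `E < ⊤` a.e. under the tilt, `Z(t+h') ≤ e^{-2h'E₀}Z(t)` (`E ≥ E₀` on `supp μ`, `expNeg` antitone and
  multiplicative) gives `(log Z(t) − log Z(t+h'))/h' ≥ 2E₀`, and Jensen for `exp` under the tilted probability
  gives `Z(t+h) ≥ Z(t)e^{-2h(E₀+B)}`, i.e. `(log Z(t) − log Z(t+h))/h ≤ 2(E₀ + B)`.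
* `EnergyExcessDecay_of : Sig.stub_spectralMeasure → Sig.stub_energyExcessBound → Sig.stub_laplaceTilt →
  EnergyExcessDecay` — PROVED below (no sorry): constants `C, ρ₀` from stub 2, `Eventually` intersection with
  stub 1, `t ≥ 0` from `Cc⁻² ≤ t`, `B = C L³c⁻³t⁻⁴ ≥ 0` by positivity (`L = (N/ρ)^{1/3} ≥ 0`, `c = √· ≥ 0`,
  even power of `t⁻¹`), the representation rewritten at `t, t+h, t+h'`, and `ring`.

Degenerate corners (checked on paper, all consistent): `a = 0` (`c = 0`, Lean junk `c⁻¹ = 0`, threshold `t ≥ 0`,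
bound `0`): the flow is then trivial, `μ = L^{3N}δ₀`, every stub true and `t = 0` is covered because the
representation includes `t = 0`; hard cores: `c > 0` so `t > 0` and the `⊤`-atom is invisible to all three `Z`'s;
`Z = 0` (no accessible configuration): all logs vanish.

## Audit

See `Lines/birth.md` (this skeleton's card) and the seat NOTES: `lean check --json` rc 0, sorries = 3 = stubs,
zero elsewhere; BC3 probes `stub → EnergyExcessDecay`, `stub → BoseEinsteinCondensation` fail for all three stubs.
-/

namespace Summit.AtomisticToContinuum.BoseEinsteinCondensation.Cruxes.EnergyExcessDecay.Birth

open scoped BigOperators Topology ENNReal NNReal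
open Filter Set MeasureTheory

/-! ### Stub statements (`Sig.stub_<name>`; the stub theorems below carry the same short names) -/

/-- SPECTRAL MEASURE OF THE CONSTANT STATE ALONG THE TORUS FLOW (identification layer).  For admissible `v`,
`ρ > 0` and all large `N`, with `L = (N/ρ)^{1/3}` and `Φ_t` the crux's Feynman–Kac flow of the constant, there is
a finite measure `μ` on `[0, ∞]` with `∫_{cell^N} Φ_t² = ∫ expNeg(2tE) dμ(E)` for every `t ≥ 0`
(`expNeg (ofReal (2t) * ⊤) = 𝟙{t = 0}`: the atom at `⊤` is the hard-core-killed mass). -/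
def Sig.stub_spectralMeasure : Prop :=
  ∀ v : ℝ → ℝ≥0∞, Literature.MathematicalPhysics.QuantumManyBody.BoseGas.IsRepulsiveFiniteRange v →
    ∀ ρ : ℝ, 0 < ρ → ∀ᶠ N : ℕ in Filter.atTop,
      let L : ℝ := Literature.MathematicalPhysics.QuantumManyBody.BoseGas.sideLength ρ N
      let Φ : ℝ → Literature.MathematicalPhysics.QuantumManyBody.BoseGas.Config N → ℝ≥0∞ := fun t X =>
        ∫⁻ ω, Literature.MathematicalPhysics.QuantumManyBody.BoseGas.expNeg
            (∫⁻ s in Set.Ioc (0 : ℝ) t,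
              Literature.MathematicalPhysics.QuantumManyBody.BoseGas.periodicInteraction v L
                (Literature.MathematicalPhysics.QuantumManyBody.BoseGas.worldLine X ω s.toNNReal))
          ∂(Literature.MathematicalPhysics.QuantumManyBody.BoseGas.wienerPaths N)
      ∃ μ : MeasureTheory.Measure ℝ≥0∞, MeasureTheory.IsFiniteMeasure μ ∧
        ∀ t : ℝ, 0 ≤ t →
          ∫⁻ X in Literature.MathematicalPhysics.QuantumManyBody.BoseGas.cellN N L, Φ t X ^ 2 =
            ∫⁻ E, Literature.MathematicalPhysics.QuantumManyBody.BoseGas.expNeg (ENNReal.ofReal (2 * t) * E) ∂μ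

/-- ENERGY EXCESS OF THE TILTED SPECTRAL MEASURE (the physics: `E_t − E_∞ ≤ C L³c⁻³t⁻⁴` for `t ≥ Cc⁻²`).
For admissible `v` there are `C, ρ₀ > 0` such that for `0 < ρ < ρ₀` and all large `N`: every finite measure
`μ` on `[0, ∞]` representing `t ↦ ∫_{cell^N} Φ_t²` as above admits a finite level `E₀` with no mass below it
and `∫ E·expNeg(2tE) dμ ≤ (E₀ + C L³c⁻³t⁻⁴) ∫ expNeg(2tE) dμ` for all `t ≥ Cc⁻²`. -/
def Sig.stub_energyExcessBound : Prop :=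
  ∀ v : ℝ → ℝ≥0∞, Literature.MathematicalPhysics.QuantumManyBody.BoseGas.IsRepulsiveFiniteRange v →
    ∃ C ρ₀ : ℝ, 0 < C ∧ 0 < ρ₀ ∧ ∀ ρ : ℝ, 0 < ρ → ρ < ρ₀ → ∀ᶠ N : ℕ in Filter.atTop,
      let L : ℝ := Literature.MathematicalPhysics.QuantumManyBody.BoseGas.sideLength ρ N
      let a : ℝ := (Literature.MathematicalPhysics.QuantumManyBody.BoseGas.scatteringLength v).toReal
      let c : ℝ := Real.sqrt (16 * Real.pi * ρ * a)
      let Φ : ℝ → Literature.MathematicalPhysics.QuantumManyBody.BoseGas.Config N → ℝ≥0∞ := fun t X =>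
        ∫⁻ ω, Literature.MathematicalPhysics.QuantumManyBody.BoseGas.expNeg
            (∫⁻ s in Set.Ioc (0 : ℝ) t,
              Literature.MathematicalPhysics.QuantumManyBody.BoseGas.periodicInteraction v L
                (Literature.MathematicalPhysics.QuantumManyBody.BoseGas.worldLine X ω s.toNNReal))
          ∂(Literature.MathematicalPhysics.QuantumManyBody.BoseGas.wienerPaths N)
      ∀ μ : MeasureTheory.Measure ℝ≥0∞, MeasureTheory.IsFiniteMeasure μ →
        (∀ t : ℝ, 0 ≤ t →
          ∫⁻ X in Literature.MathematicalPhysics.QuantumManyBody.BoseGas.cellN N L, Φ t X ^ 2 =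
            ∫⁻ E, Literature.MathematicalPhysics.QuantumManyBody.BoseGas.expNeg (ENNReal.ofReal (2 * t) * E) ∂μ) →
        ∃ E₀ : ℝ≥0, μ (Set.Iio (E₀ : ℝ≥0∞)) = 0 ∧ ∀ t : ℝ, C * c⁻¹ ^ 2 ≤ t →
          ∫⁻ E, E * Literature.MathematicalPhysics.QuantumManyBody.BoseGas.expNeg (ENNReal.ofReal (2 * t) * E) ∂μ ≤
            ((E₀ : ℝ≥0∞) + ENNReal.ofReal (C * L ^ 3 * c⁻¹ ^ 3 * t⁻¹ ^ 4)) *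
              ∫⁻ E, Literature.MathematicalPhysics.QuantumManyBody.BoseGas.expNeg (ENNReal.ofReal (2 * t) * E) ∂μ

/-- ABSTRACT LAPLACE-TRANSFORM INEQUALITY (log-convexity of `Z` + Jensen under the Gibbs tilt; provable now).
For a finite measure `μ` on `[0, ∞]`, a level `E₀` with `μ(Iio E₀) = 0`, `B ≥ 0`, `t ≥ 0` and `0 < h ≤ h'`: if the
tilted mean at `t` is at most `E₀ + B` then, with `Z(s) = (∫ expNeg(2sE) dμ).toReal`,
`(log Z(t) − log Z(t+h))/h − (log Z(t) − log Z(t+h'))/h' ≤ 2B`. -/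
def Sig.stub_laplaceTilt : Prop :=
  ∀ μ : MeasureTheory.Measure ℝ≥0∞, MeasureTheory.IsFiniteMeasure μ → ∀ (E₀ : ℝ≥0) (B t h h' : ℝ),
    μ (Set.Iio (E₀ : ℝ≥0∞)) = 0 → 0 ≤ B → 0 ≤ t → 0 < h → h ≤ h' →
    ∫⁻ E, E * Literature.MathematicalPhysics.QuantumManyBody.BoseGas.expNeg (ENNReal.ofReal (2 * t) * E) ∂μ ≤
        ((E₀ : ℝ≥0∞) + ENNReal.ofReal B) *
          ∫⁻ E, Literature.MathematicalPhysics.QuantumManyBody.BoseGas.expNeg (ENNReal.ofReal (2 * t) * E) ∂μ →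
    let Z : ℝ → ℝ := fun s =>
      (∫⁻ E, Literature.MathematicalPhysics.QuantumManyBody.BoseGas.expNeg (ENNReal.ofReal (2 * s) * E) ∂μ).toReal
    (Real.log (Z t) - Real.log (Z (t + h))) / h - (Real.log (Z t) - Real.log (Z (t + h'))) / h' ≤ 2 * B

/-! ### The stubs -/

/-- stub 1 [L]: spectral measure on `[0, ∞]` of the constant state along the torus flow, every `t ≥ 0`. -/
theorem stub_spectralMeasure : Sig.stub_spectralMeasure := by
  sorry

/-- stub 2 [XL, hardest]: tilted-mean energy excess `≤ C L³c⁻³t⁻⁴` above a mass-free level, `t ≥ Cc⁻²`. -/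
theorem stub_energyExcessBound : Sig.stub_energyExcessBound := by
  sorry

/-- stub 3 [M, provable now]: the abstract Laplace-transform / Jensen inequality. -/
theorem stub_laplaceTilt : Sig.stub_laplaceTilt := by
  sorry

/-! ### Composition -/

/-- COMPOSITION (kernel-checked, no sorry): the three stubs give the crux BY NAME. -/
theorem EnergyExcessDecay_of :
    Sig.stub_spectralMeasure → Sig.stub_energyExcessBound → Sig.stub_laplaceTilt →
      Summit.AtomisticToContinuum.BoseEinsteinCondensation.Theses.BECCovarianceTransport.EnergyExcessDecay := by
  intro hA hB hC v hv
  obtain ⟨C, ρ₀, hC0, hρ₀, HB⟩ := hB v hv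
  refine ⟨C, ρ₀, hC0, hρ₀, fun ρ hρ hρlt => ?_⟩
  filter_upwards [hA v hv ρ hρ, HB ρ hρ hρlt] with N hAN hBN
  dsimp only at hAN hBN ⊢
  obtain ⟨μ, hfin, hrep⟩ := hAN
  obtain ⟨E₀, hE₀, hbd⟩ := hBN μ hfin hrep
  intro t h h' ht hh hhh'
  have ht0 : (0 : ℝ) ≤ t := le_trans (by positivity) ht
  have hL : (0 : ℝ) ≤ Literature.MathematicalPhysics.QuantumManyBody.BoseGas.sideLength ρ N := by
    unfold Literature.MathematicalPhysics.QuantumManyBody.BoseGas.sideLength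
    exact Real.rpow_nonneg (div_nonneg (Nat.cast_nonneg _) hρ.le) _
  have key := hC μ hfin E₀ _ t h h' hE₀ (by positivity) ht0 hh hhh' (hbd t ht)
  dsimp only at key
  rw [hrep t ht0, hrep (t + h) (by linarith), hrep (t + h') (by linarith)]
  exact key.trans (le_of_eq (by ring))

/-- REGISTERED TARGET of the skeleton — the crux BY NAME with no hypotheses: `EnergyExcessDecay_of` applied to
the three declared stubs (the only `sorry`s of the file live in `stub_*`). -/
theorem EnergyExcessDecay_of_stubs :
    Summit.AtomisticToContinuum.BoseEinsteinCondensation.Theses.BECCovarianceTransport.EnergyExcessDecay :=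
  EnergyExcessDecay_of stub_spectralMeasure stub_energyExcessBound stub_laplaceTilt

end Summit.AtomisticToContinuum.BoseEinsteinCondensation.Cruxes.EnergyExcessDecay.Birth
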